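import Summits.NavierStokesRegularity.FluidComputer.PalasekTowerRegisterWindow

/-!
# REGISTER: the push budget on the wide-base rates — every push constant `c₄ ≤ c₁` passes the pins

Cell `ns-blowup`, seat `ns-blowup-ecbridge-4` (g0); companion of `PalasekTowerRegister.lean` (p407242:
`Schedule.Rigid`, `c₁ = 1`, `c₂ = 5/3`, `c₅ = 4bβ`, window equality), `PalasekTowerEpisodesPinned.lean`
(`Schedule.Pins`: the impulse clause `Λ · c₄ Y_k · (τ_{k+1} − τ_k) ≤ c₁ Y_{k+1} − c₂ Y_k`) and
`PalasekTowerRegisterWindow.lean` (`TowerRates.window`, `wide_log_N_ge`). LABEL: E–C typing (KERNEL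
rate arithmetic). WHAT THIS IS NOT: not Navier–Stokes evidence — numbers about the registered constants,
no flow.

## Why (planner OBJECTION STATUS l.1832 «re-type `first_episode` in RE-FORCING form»; ecbridge-4 l.1875)

A re-forced / re-pushed schedule must be shown PINNED again. On a RIGID schedule on the wide-base rates
(`N₀ = 256`, `b = 11/10`, `β = 23/10`) the impulse clause never binds: for every push constant
`0 ≤ c ≤ 1 = c₁` and every level `k`,

* `TowerRates.wide_Y_mul_window_le`: `Y_k · w_k ≤ 1/4`, where `w_k = 4bβ log N_{k+1} / A_k` is the rigid
  growth window (`Y_k w_k = 4b²β · log N_k / N_k ≤ 11.132 · log 256 / 256 ≈ 0.2411`, `log x / x`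
  antitone on `[e, ∞)`);
* `Schedule.Rigid.push_impulse_le`: the direct impulse of any admissible window force is
  `c · Y_k · (τ_{k+1} − τ_k) ≤ 1/4` — against a jump of the maximal speed `≥ c₁ Y_{k+1} − c₂ Y_k ≥ Y_k/3`
  (`≥ 450` at `k = 0`; at `k = 0` the jump from the ANCHORED maximum `c₁ Y₀` is even `≥ Y₁ − Y₀ ≥ Y₀`,
  `PalasekTowerRegisterGlobalFirstHitting.Stage.first_jump`);
* `Schedule.Rigid.impulse_pin_of_le_one`: `8 · (c Y_k) · (τ_{k+1} − τ_k) ≤ c₁ Y_{k+1} − c₂ Y_k` — the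
  impulse clause of `Pins 8 θ` for ANY push constant `c ∈ [0, 1]`; with `Schedule.Rigid.sep_wide`
  (`θ = 6/5`) and confinement this is all of `Pins 8 (6/5)` (`Schedule.Rigid.pins_of_push_le_one`).

So «choose the push» in a re-typed first episode costs nothing at the level of the pins, and the push
it buys moves velocities by at most `1/4` per window: the episode is won or lost by the host's own
dynamics. [cite: Palasek2026ElementaryModel, §3.3]
-/

noncomputable section

namespace Summit.NavierStokesRegularity.FluidComputer.PalasekTowerClayBridge

open Set Filter Topology Function Real
open scoped NNReal

namespace TowerRates

/-- `Y_k / A_k = 1 / N_k` (`Y = N^{β-1}`, `A = N^β`). [folklore] -/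
theorem Y_div_A (R : TowerRates) (k : ℕ) : R.Y k / R.A k = (R.N k)⁻¹ := by
  have hN := R.N_pos k
  have h2 : R.N k ^ R.β ≠ 0 := (Real.rpow_pos_of_pos hN _).ne'
  simp only [TowerRates.Y, TowerRates.A]
  rw [Real.rpow_sub_one hN.ne', div_right_comm, div_self h2, one_div]

/-- `Y_k · w_k = 4 b² β · log N_k / N_k` for the rigid window `w_k = 4bβ log N_{k+1} / A_k`.
[folklore] -/
theorem Y_mul_window (R : TowerRates) (k : ℕ) :
    R.Y k * R.window k = 4 * R.b ^ 2 * R.β * (Real.log (R.N k) / R.N k) := by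
  unfold TowerRates.window
  rw [R.log_N_succ k]
  have h := R.Y_div_A k
  calc R.Y k * (4 * R.b * R.β * (R.b * Real.log (R.N k)) / R.A k)
      = 4 * R.b ^ 2 * R.β * Real.log (R.N k) * (R.Y k / R.A k) := by ring
    _ = 4 * R.b ^ 2 * R.β * (Real.log (R.N k) / R.N k) := by rw [h]; ring

/-- On the wide-base rates `log N_k / N_k ≤ log 256 / 256` (`log x / x` is antitone on `[e, ∞)` and
`N_k ≥ N₀ = 256 ≥ e`). [folklore] -/
theorem wide_log_div_N_le (k : ℕ) :
    Real.log (wide.N k) / wide.N k ≤ Real.log 256 / 256 := by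
  have hN₀ : wide.N₀ = 256 := rfl
  have hNk : (256 : ℝ) ≤ wide.N k := by
    have := wide.N₀_le_N k
    rwa [hN₀] at this
  have he : Real.exp 1 ≤ (256 : ℝ) := by
    have := Real.exp_one_lt_three
    linarith
  have h := Real.log_div_self_antitoneOn (a := 256) (b := wide.N k) he (le_trans he hNk) hNk
  simpa using h

/-- **The velocity scale times the rigid window is at most `1/4` on the wide base**:
`Y_k w_k = 4b²β log N_k / N_k ≤ 11.132 · (8 log 2) / 256 < 1/4`. [folklore] -/
theorem wide_Y_mul_window_le (k : ℕ) : wide.Y k * wide.window k ≤ 1 / 4 := by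
  rw [wide.Y_mul_window k]
  have hb : wide.b = 11 / 10 := rfl
  have hβ : wide.β = 23 / 10 := rfl
  rw [hb, hβ]
  have h1 := wide_log_div_N_le k
  have h2 : Real.log (256 : ℝ) = 8 * Real.log 2 := by
    rw [show (256 : ℝ) = 2 ^ 8 by norm_num, Real.log_pow]
    norm_num
  have h3 := Real.log_two_lt_d9
  rw [h2] at h1
  nlinarith

/-- The velocity scales dominate the base scale: `Y₀ ≤ Y_k`. [folklore] -/
theorem Y_zero_le (R : TowerRates) (k : ℕ) : R.Y 0 ≤ R.Y k := by
  have hmono : Monotone R.Y := monotone_nat_of_le_succ fun n => (R.Y_lt_Y_succ n).le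
  exact hmono (Nat.zero_le k)

/-- On the wide base `Y_k ≥ Y₀ = 256^{13/10} ≥ 256`. [folklore] -/
theorem wide_Y_ge (k : ℕ) : (256 : ℝ) ≤ wide.Y k := by
  refine le_trans ?_ (wide.Y_zero_le k)
  have hN₀ : wide.N 0 = 256 := by simp [TowerRates.N, wide]
  have hβ : wide.β = 23 / 10 := rfl
  simp only [TowerRates.Y]
  rw [hN₀, hβ]
  have : (256 : ℝ) = (256 : ℝ) ^ (1 : ℝ) := (Real.rpow_one _).symm
  conv_lhs => rw [this]
  exact Real.rpow_le_rpow_of_exponent_le (by norm_num) (by norm_num)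

end TowerRates

namespace Schedule.Rigid

variable {S : Schedule TowerRates.wide}

/-- Under rigidity the readout gap IS the rigid window: `τ_{k+1} − τ_k = w_k = 4bβ log N_{k+1} / A_k`.
[folklore] -/
theorem gap_eq_window (h : S.Rigid) (k : ℕ) :
    S.τ (k + 1) - S.τ k = TowerRates.wide.window k := by
  unfold TowerRates.window
  rw [h.window_eq k, h.c₅_eq]
  ring

/-- **The push budget**: on a rigid schedule on the wide base, an admissible window force with push
constant `0 ≤ c ≤ 1` has direct impulse `c · Y_k · (τ_{k+1} − τ_k) ≤ 1/4` on every growth interval.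
[cite: Palasek2026ElementaryModel, §3.3] -/
theorem push_impulse_le (h : S.Rigid) {c : ℝ} (hc1 : c ≤ 1) (k : ℕ) :
    c * TowerRates.wide.Y k * (S.τ (k + 1) - S.τ k) ≤ 1 / 4 := by
  rw [h.gap_eq_window k]
  have h1 := TowerRates.wide_Y_mul_window_le k
  have hY : 0 < TowerRates.wide.Y k := Real.rpow_pos_of_pos (TowerRates.wide.N_pos k) _
  have hw : 0 < TowerRates.wide.window k := TowerRates.wide.window_pos k
  calc c * TowerRates.wide.Y k * TowerRates.wide.window k
      ≤ 1 * TowerRates.wide.Y k * TowerRates.wide.window k := by gcongr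
    _ = TowerRates.wide.Y k * TowerRates.wide.window k := by ring
    _ ≤ 1 / 4 := h1

/-- **The jump the pins demand dwarfs the push**: on a rigid schedule on the wide base the impulse
right-hand side is `c₁ Y_{k+1} − c₂ Y_k = Y_{k+1} − (5/3) Y_k ≥ Y_k / 3 ≥ 256/3`. [folklore] -/
theorem jump_ge (h : S.Rigid) (k : ℕ) :
    TowerRates.wide.Y k / 3 ≤ S.c₁ * TowerRates.wide.Y (k + 1) - S.c₂ * TowerRates.wide.Y k := by
  rw [h.c₁_eq, h.c₂_eq]
  have := TowerRates.wide_sep k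
  linarith

/-- **Every push constant `c ∈ [0, 1]` passes the impulse clause of `Pins 8 θ` on a rigid schedule on
the wide base**: `8 · (c Y_k) · (τ_{k+1} − τ_k) ≤ 2 ≤ 256/3 ≤ c₁ Y_{k+1} − c₂ Y_k`. [folklore] -/
theorem impulse_pin_of_le_one (h : S.Rigid) {c : ℝ} (hc1 : c ≤ 1) (k : ℕ) :
    8 * (c * TowerRates.wide.Y k) * (S.τ (k + 1) - S.τ k) ≤
      S.c₁ * TowerRates.wide.Y (k + 1) - S.c₂ * TowerRates.wide.Y k := by
  have h1 := h.push_impulse_le hc1 k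
  have h2 := h.jump_ge k
  have h3 := TowerRates.wide_Y_ge k
  nlinarith

/-- **Re-pushing keeps the pins**: a rigid schedule on the wide base whose push constant lies in
`[0, 1]` and whose datum and force are confined to the ball satisfies `Pins 8 (6/5)` (impulse by
`impulse_pin_of_le_one`, separation by `Rigid.sep_wide`). [folklore] -/
theorem pins_of_push_le_one (h : S.Rigid) (hc1 : S.c₄ ≤ 1)
    (hd : ∀ x, S.radius < ‖x‖ → S.u₀ x = 0) (hf : ∀ t x, S.radius < ‖x‖ → S.f t x = 0) :
    S.Pins 8 (6 / 5) :=
  ⟨fun k => h.impulse_pin_of_le_one hc1 k, fun k => h.sep_wide k, hd, hf⟩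

end Schedule.Rigid

end Summit.NavierStokesRegularity.FluidComputer.PalasekTowerClayBridge

end
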